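import Literature.IUT.HodgeArakelov.CohomologyLimitKummer

/-!
# Torsion classes in `lim_K H¹(H ⊓ K, A')` are Kummer classes of roots of unity

Proof-only companion (abc-iut cell, seat abc-iut-w5-d098; GAP-LEDGER row `G-w4d043-1`, the binder `hμ` of
[IUTchII] Cor. 1.12 (ii) at the model) of `CohomologyLimitKummer.lean` (abc-iut layer L6) over layer L2's
continuous Kummer theory (`EtaleTheta/KummerContH1.lean`, `KummerContH1Kernel.lean`, `Cyclotome.lean`).

Classical content [cite: NeukirchSchmidtWingberg2008, II §7] (Kummer theory; for a `p`-adic local field `k′`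
the torsion of `H¹(G_{k′}, Ẑ(1)) = (k′ˣ)^∧` is `μ(k′)`), in the abstract shape the tree uses
([cite: LANA2026Report, §6.1 p.31]: `Λ(A) = lim_n A[n]`, Kummer cocycles of compatible root systems):

* `cyclotome.eq_one_of_pow_eq_one` — **the cyclotome `Λ(A)` of ANY commutative group is torsion-free**
  (`ζ^N = 1 ⇒ ζ_n = ζ_{nN}^N = 1`); hence, for BIJECTIVE cyclotome coefficients `c : Λ(A) ⥲ A'`, `N`-th powers
  are injective on `A'` (`CyclotomeCoefficients.eq_of_pow_eq_pow`);
* `cyclotome.rootSystemAt ζ N` — the compatible root system `m ↦ ζ_{N·m}` of the `N`-torsion element `ζ_N`, and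
  `cyclotome.kummerCocycle_rootSystemAt_pow`: the `N`-th power of its Kummer cocycle is `h ↦ h•ζ/ζ`;
* **`CohomologySystemOfContH1.exists_h1LimKummer_eq_of_isOfFinAddOrder`** — for bijective `c`, EVERY TORSION
  class `y` of the limit `h1Lim φ A' H ⊥ = lim_K H¹(H ⊓ K, A')` is the Kummer class `h1LimKummer u` of a torsion
  element `u ∈ A` (a root of unity): if `N • y = 0` then at some finite-index open level the `N`-th power of a
  representing cocycle `f` is the coboundary of `c(ζ)`, `ζ ∈ Λ(A)`, and the Kummer cocycle `κ` of `u := ζ⁻¹_N`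
  has `κ^N = f^N`, whence `κ = f` by torsion-freeness; `…_mem_…` is the `∃ u ∈ U` form for any subgroup `U`
  containing the torsion of `A` (the row's `U = 𝒪^×_{k̄} ⊇ μ(k̄)`).

No hypothesis beyond those of `h1LimKummer` (`hA`, `hfi`, `[RootableBy A ℕ]`) and `Function.Bijective c.hom`
(the consumers' `hc`). Nothing here bears on [IUTchIII] Cor. 3.12.
-/

namespace Literature.AnabelianGeometry.EtaleTheta

/-! ### The cyclotome is torsion-free -/

namespace cyclotome

variable {A : Type*} [CommGroup A]

/-- Components of a power of an element of the cyclotome. [cite: LANA2026Report, §6.1 p.31] -/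
theorem coe_pow_apply (ζ : cyclotome A) (N : ℕ) (n : ℕ+) :
    ((ζ ^ N : cyclotome A) : ℕ+ → A) n = (ζ : ℕ+ → A) n ^ N := by
  rw [Subgroup.coe_pow, Pi.pow_apply]

/-- **The cyclotome `Λ(A) = lim_n A[n]` of any commutative group is torsion-free**: if `ζ ^ N = 1` for some
`N ≥ 1` then `ζ = 1`, since `ζ_n = ζ_{nN}^N = (ζ^N)_{nN} = 1`. [cite: LANA2026Report, §6.1 p.31] -/
theorem eq_one_of_pow_eq_one (ζ : cyclotome A) (N : ℕ+) (h : ζ ^ (N : ℕ) = 1) : ζ = 1 := by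
  refine Subtype.ext (funext fun n => ?_)
  have h1 : ((ζ ^ (N : ℕ) : cyclotome A) : ℕ+ → A) (n * N) = 1 := by
    rw [h]; rfl
  rw [coe_pow_apply, pow_apply_mul] at h1
  rw [h1]; rfl

/-- Raising to the `N`-th power (`N ≥ 1`) is injective on the cyclotome. [cite: LANA2026Report, §6.1 p.31] -/
theorem pow_left_injective (N : ℕ+) {ζ ξ : cyclotome A} (h : ζ ^ (N : ℕ) = ξ ^ (N : ℕ)) : ζ = ξ := by
  have h' : (ζ / ξ) ^ (N : ℕ) = 1 := by rw [div_pow, h, div_self']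
  exact div_eq_one.mp (eq_one_of_pow_eq_one _ N h')

/-! ### The compatible root system `m ↦ ζ_{N·m}` of the `N`-torsion element `ζ_N` -/

/-- For `ζ ∈ Λ(A)` and `N ≥ 1`, the components `m ↦ ζ_{N·m}` form a compatible system of roots of the
`N`-torsion element `ζ_N ∈ A` (`ζ_{N·nm}^m = ζ_{N·n}`). [cite: LANA2026Report, §6.1 p.31] -/
def rootSystemAt (ζ : cyclotome A) (N : ℕ+) : RootSystem ((ζ : ℕ+ → A) N) where
  root m := (ζ : ℕ+ → A) (N * m)
  root_one := by rw [mul_one]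
  root_mul_pow n m := by
    rw [← mul_assoc]
    exact cyclotome.pow_apply_mul ζ (N * n) m

/-- The roots of `rootSystemAt ζ N`. [cite: LANA2026Report, §6.1 p.31] -/
@[simp] theorem rootSystemAt_root (ζ : cyclotome A) (N m : ℕ+) :
    (rootSystemAt ζ N).root m = (ζ : ℕ+ → A) (N * m) := rfl

variable {G : Type*} [Group G] [MulDistribMulAction G A]

/-- **The `N`-th power of the Kummer cocycle of `ζ_N`** (computed with the root system `m ↦ ζ_{N·m}`) is the
"coboundary of `ζ` in `Λ(A)`": `κ(h)^N = h • ζ / ζ`, because `ζ_{N·m}^N = ζ_m`. [cite: LANA2026Report, §6.1 p.31] -/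
theorem kummerCocycle_rootSystemAt_pow (ζ : cyclotome A) (N : ℕ+) {H : Subgroup G}
    (ha : (ζ : ℕ+ → A) N ∈ MulAction.fixedPoints H A) (h : H) :
    (rootSystemAt ζ N).kummerCocycle ha h ^ (N : ℕ) = (h : G) • ζ / ζ := by
  refine Subtype.ext (funext fun m => ?_)
  have key : (ζ : ℕ+ → A) (N * m) ^ (N : ℕ) = (ζ : ℕ+ → A) m := by
    rw [mul_comm]; exact cyclotome.pow_apply_mul ζ m N
  rw [coe_pow_apply, RootSystem.kummerCocycle_apply, rootSystemAt_root, Subgroup.smul_def, div_pow,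
    ← smul_pow', key, Subgroup.coe_div, Pi.div_apply, coe_smul, Pi.smul_apply]

end cyclotome

/-! ### Bijective cyclotome coefficients: `N`-th powers are injective on `A'` -/

namespace CyclotomeCoefficients

variable {G G' : Type*} [Group G] [Group G'] [TopologicalSpace G']
  {φ : G →* G'} {A' : Subgroup G'} [A'.Normal]
  {A : Type*} [CommGroup A] [MulDistribMulAction G A] [TopologicalSpace A]
  (c : CyclotomeCoefficients φ A' A)

/-- If the coefficient map `c : Λ(A) → A'` is bijective, then `A' ≅ Λ(A)` is torsion-free: equal `N`-th powers
(`N ≥ 1`) have equal bases. [cite: LANA2026Report, §6.1 p.31] -/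
theorem eq_of_pow_eq_pow (hc : Function.Bijective c.hom) (N : ℕ+) {a b : A'}
    (h : a ^ (N : ℕ) = b ^ (N : ℕ)) : a = b := by
  obtain ⟨ζ, rfl⟩ := hc.2 a
  obtain ⟨ξ, rfl⟩ := hc.2 b
  rw [← map_pow, ← map_pow] at h
  rw [cyclotome.pow_left_injective N (hc.1 h)]

end CyclotomeCoefficients

end Literature.AnabelianGeometry.EtaleTheta

/-! ### Torsion classes of the limit are Kummer classes of roots of unity -/

namespace Literature.IUT.HodgeArakelov

open Literature.AnabelianGeometry.EtaleTheta CohomologySystemOfContH1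

noncomputable section

namespace CohomologySystemOfContH1

variable {P : TopGroup.{0}} {G' : Type} [Group G'] [TopologicalSpace G'] [IsTopologicalGroup G']
  (φ : P →* G') (A' : Subgroup G') [A'.Normal] [IsMulCommutative A'] (H : Subgroup P)
  {A : Type} [CommGroup A] [MulDistribMulAction P A] [TopologicalSpace A] [RootableBy A ℕ]
  (c : CyclotomeCoefficients φ A' A)
  (hA : ∀ b : A, IsOpen (MulAction.stabilizer P b : Set P))
  (hfi : ∀ b : A, (MulAction.stabilizer P b).FiniteIndex)

omit [RootableBy A ℕ] in
/-- Every element of a member `H¹(H ⊓ K, A')` of the directed system is the class of a continuous cocycle.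
[cite: NeukirchSchmidtWingberg2008, I §2 and II §7] -/
theorem exists_mk_eq (i : Idx (P := P) ⊥) (x : Gmod φ A' H ⊥ i) :
    ∃ (f : ↥(H ⊓ i.K) → A') (hf : f ∈ contCocycles φ A' (H ⊓ i.K)), Additive.ofMul (ContH1.mk f hf) = x := by
  induction x using Additive.ofMul.surjective.forall.2 with
  | _ z =>
    induction z using QuotientGroup.induction_on with
    | H g => exact ⟨g.1, g.2, rfl⟩

omit [RootableBy A ℕ] in
/-- Powers of classes are classes of powers of cocycles. [cite: NeukirchSchmidtWingberg2008, I §2 and II §7] -/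
theorem mk_pow {H₁ : Subgroup P} (f : H₁ → A') (hf : f ∈ contCocycles φ A' H₁) (N : ℕ) :
    (ContH1.mk f hf : ContH1 φ A' H₁) ^ N = ContH1.mk (f ^ N) (pow_mem hf N) := rfl

omit [RootableBy A ℕ] in
/-- The transition map applied to a class: restriction of the representing cocycle.
[cite: NeukirchSchmidtWingberg2008, I §5] -/
theorem fmod_ofMul_mk {i j : Idx (P := P) ⊥} (hij : i ≤ j) (f : ↥(H ⊓ i.K) → A')
    (hf : f ∈ contCocycles φ A' (H ⊓ i.K)) :
    fmod φ A' H ⊥ i j hij (Additive.ofMul (ContH1.mk f hf)) =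
      Additive.ofMul (ContH1.mk (φ := φ) (A := A') (H := H ⊓ j.K)
        (fun h => f ⟨h.1, inf_le_inf_left H (Idx.le_iff.mp hij) h.2⟩)
        (ContH1.resCocycle φ A' (inf_le_inf_left H (Idx.le_iff.mp hij)) ⟨f, hf⟩).2) :=
  rfl

omit [RootableBy A ℕ] in
/-- **A torsion relation at a level.** If the class of the cocycle `f` at level `K_i` becomes `N`-torsion in the
limit, then at some finer level `K_j` there is `ξ ∈ Λ(A)` with `f(h)^N = c(h • ξ / ξ)` for all `h ∈ H ⊓ K_j`
(exactness of the direct limit at a generator + unfolding of "coboundary" + equivariance of `c`; needs `c`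
surjective). [cite: NeukirchSchmidtWingberg2008, II §7] -/
theorem exists_level_pow_eq_coboundary (hc : Function.Bijective c.hom) (i : Idx (P := P) ⊥)
    (f : ↥(H ⊓ i.K) → A') (hf : f ∈ contCocycles φ A' (H ⊓ i.K)) (N : ℕ)
    (hN : N • h1Of φ A' H ⊥ i (Additive.ofMul (ContH1.mk f hf)) = 0) :
    ∃ (j : Idx (P := P) ⊥) (hij : i ≤ j) (ξ : cyclotome A), ∀ h : ↥(H ⊓ j.K),
      f ⟨h.1, inf_le_inf_left H (Idx.le_iff.mp hij) h.2⟩ ^ N = c.hom ((h : P) • ξ / ξ) := by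
  haveI := Idx.isDirected (P := P) (⊥ : Subgroup P)
  haveI : Nonempty (Idx (P := P) ⊥) := ⟨Idx.top ⊥⟩
  haveI : DirectedSystem (Gmod φ A' H ⊥) fun i j hij => fmod φ A' H ⊥ i j hij := directedSystem φ A' H ⊥
  have h0 : h1Of φ A' H ⊥ i (N • Additive.ofMul (ContH1.mk f hf)) = 0 := by rw [map_nsmul]; exact hN
  obtain ⟨j, hij, hj⟩ := AddCommGroup.DirectLimit.of.zero_exact (G := Gmod φ A' H ⊥) (f := fmod φ A' H ⊥)
    i _ h0
  refine ⟨j, hij, ?_⟩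
  rw [map_nsmul, fmod_ofMul_mk, ← ofMul_pow, mk_pow, ofMul_eq_zero, ← ContH1.mk_one,
    ContH1.mk_eq_mk_iff] at hj
  obtain ⟨α, hα⟩ := hj
  obtain ⟨ζ, rfl⟩ := hc.2 α
  refine ⟨ζ⁻¹, fun h => ?_⟩
  have hh := hα h
  rw [Pi.one_apply, mul_one, Pi.pow_apply, ← c.hom_smul, ← map_inv, ← map_mul] at hh
  -- `hh : (f h ^ N)⁻¹ = c (h • ζ * ζ⁻¹)`
  rw [← inv_inj, hh, ← map_inv]
  congr 1
  rw [smul_inv', inv_div_inv, inv_div, div_eq_mul_inv]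

/-- **Every torsion class of `lim_K H¹(H ⊓ K, A')` is the Kummer class of a root of unity.** For bijective
cyclotome coefficients `c : Λ(A) ⥲ A'`: if `y ∈ h1Lim φ A' H ⊥` has finite (additive) order, then
`y = κ(u)` (`h1LimKummer`) for a TORSION element `u ∈ A`. Classically (`A = k̄ˣ`, `A' = Ẑ(1)`, `H ⊓ K = G_{k′}`):
the torsion of `lim_{k′} H¹(G_{k′}, Ẑ(1)) = lim_{k′} (k′ˣ)^∧` consists of the Kummer classes of the roots of unity
`μ(k̄)`. [cite: NeukirchSchmidtWingberg2008, II §7] -/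
theorem exists_h1LimKummer_eq_of_isOfFinAddOrder (hc : Function.Bijective c.hom) (y : h1Lim φ A' H ⊥)
    (hy : IsOfFinAddOrder y) :
    ∃ u : A, IsOfFinOrder u ∧ h1LimKummer φ A' H c hA hfi u = Multiplicative.ofAdd y := by
  haveI := Idx.isDirected (P := P) (⊥ : Subgroup P)
  haveI : Nonempty (Idx (P := P) ⊥) := ⟨Idx.top ⊥⟩
  haveI : DirectedSystem (Gmod φ A' H ⊥) fun i j hij => fmod φ A' H ⊥ i j hij := directedSystem φ A' H ⊥
  -- the order `N ≥ 1` of `y`, a representing cocycle `f` at a level `i`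
  obtain ⟨N, hN, hNy⟩ := hy.exists_nsmul_eq_zero
  induction y using AddCommGroup.DirectLimit.induction_on with
  | ih i x =>
    obtain ⟨f, hf, rfl⟩ := exists_mk_eq φ A' H i x
    -- a finer level `j` with `f^N = ` coboundary of `c ξ⁻¹`
    obtain ⟨j, hij, ξ, hξ⟩ := exists_level_pow_eq_coboundary φ A' H c hc i f hf N hNy
    -- the root of unity `u := ξ_N` and its root system `m ↦ ξ_{N m}`
    let N' : ℕ+ := ⟨N, hN⟩
    refine ⟨(ξ : ℕ+ → A) N', isOfFinOrder_iff_pow_eq_one.mpr ⟨N, hN, cyclotome.pow_eq_one ξ N'⟩, ?_⟩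
    -- a common level `k` below `j` and the stabiliser of `u`
    obtain ⟨k, hjk, hsk⟩ := directed_of (· ≤ ·) j (stabIdx hA hfi ((ξ : ℕ+ → A) N'))
    have hik : i ≤ k := hij.trans hjk
    have hbk : (ξ : ℕ+ → A) N' ∈ MulAction.fixedPoints ↥(H ⊓ k.K) A :=
      mem_fixedPoints_of_le H hsk (mem_fixedPoints_stabIdx H hA hfi _)
    change _ = Multiplicative.ofAdd (h1Of φ A' H ⊥ i (Additive.ofMul (ContH1.mk f hf)))
    rw [h1LimKummer_eq_h1Of φ A' H c hA hfi _ k hbk,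
      kummerGmod_eq_of_rootSystem φ A' H c hA k _ hbk (cyclotome.rootSystemAt ξ N'),
      ← h1Of_fmod φ A' H ⊥ hik, fmod_ofMul_mk]
    congr 2
    refine congrArg Additive.ofMul (ContH1.mk_congr (H ⊓ k.K) (funext fun h => ?_) _ _)
    -- pointwise: `κ(h)` and `f(h)` have the same `N`-th power in the torsion-free group `A'`
    apply c.eq_of_pow_eq_pow hc N'
    rw [← map_pow, cyclotome.kummerCocycle_rootSystemAt_pow]
    exact (hξ ⟨h.1, inf_le_inf_left H (Idx.le_iff.mp hjk) h.2⟩).symm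

/-- The `∃ u ∈ U` form of `exists_h1LimKummer_eq_of_isOfFinAddOrder` for any subgroup `U ≤ A` containing the
torsion of `A` — the shape of GAP-LEDGER row `G-w4d043-1` (`U = 𝒪^×_{k̄} ⊇ μ(k̄)`, binder `hμ` of [IUTchII]
Cor. 1.12 (ii) at the model). [cite: NeukirchSchmidtWingberg2008, II §7] -/
theorem exists_mem_h1LimKummer_eq_of_isOfFinAddOrder (hc : Function.Bijective c.hom) (U : Subgroup A)
    (hU : ∀ u : A, IsOfFinOrder u → u ∈ U) (y : h1Lim φ A' H ⊥) (hy : IsOfFinAddOrder y) :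
    ∃ u ∈ U, h1LimKummer φ A' H c hA hfi u = Multiplicative.ofAdd y := by
  obtain ⟨u, hu, h⟩ := exists_h1LimKummer_eq_of_isOfFinAddOrder φ A' H c hA hfi hc y hy
  exact ⟨u, hU u hu, h⟩

/-- Conversely, the Kummer class of a torsion element is a torsion class (`κ` is a homomorphism).
[cite: NeukirchSchmidtWingberg2008, II §7] -/
theorem isOfFinAddOrder_h1LimKummer (u : A) (hu : IsOfFinOrder u) :
    IsOfFinAddOrder (Multiplicative.toAdd (h1LimKummer φ A' H c hA hfi u)) := by
  obtain ⟨N, hN, huN⟩ := hu.exists_pow_eq_one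
  refine isOfFinAddOrder_iff_nsmul_eq_zero.mpr ⟨N, hN, ?_⟩
  rw [← toAdd_pow, ← map_pow, huN, map_one, toAdd_one]

/-- **The torsion of the image**: for bijective `c` and a subgroup `U` containing the torsion of `A`, the torsion
classes of the limit are EXACTLY the Kummer classes of torsion elements of `U`.
[cite: NeukirchSchmidtWingberg2008, II §7] -/
theorem isOfFinAddOrder_iff_exists_h1LimKummer_eq (hc : Function.Bijective c.hom) (y : h1Lim φ A' H ⊥) :
    IsOfFinAddOrder y ↔ ∃ u : A, IsOfFinOrder u ∧ h1LimKummer φ A' H c hA hfi u = Multiplicative.ofAdd y := by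
  refine ⟨exists_h1LimKummer_eq_of_isOfFinAddOrder φ A' H c hA hfi hc y, ?_⟩
  rintro ⟨u, hu, h⟩
  have := isOfFinAddOrder_h1LimKummer φ A' H c hA hfi u hu
  rwa [h, toAdd_ofAdd] at this

end CohomologySystemOfContH1

end

end Literature.IUT.HodgeArakelov
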